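import Summits.HubbardSuperconductivity.HubbardSuperconductivity.Theorems.BalabanIRBirGroundStateAverageLRO
import Summits.HubbardSuperconductivity.HubbardSuperconductivity.Theorems.BalabanIRBirGroundStateAverageLROSoftminTransferFree

/-!
# Line `Sketch` (softmin-pair-penalty) — skeleton for crux `BalabanIR.BirGroundStateAverageLRO`
(item `stmt-HubbardSuperconductivity-2079`, route BalabanIR; line lead prover-line-stmt-HubbardSuperconductivity-2079-1,
pass 2 — continuation of lead -0's skeleton `ce02266704a2`)

Lever (card `Cruxes/BirGroundStateAverageLRO/Ideas/softmin-pair-penalty.md`, (★)): for every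
normalised ground state `ψ` of `H = hubbardTorus 2 L 1 U` in the sector `S = szSector N_L 0`,
with `A = Δ_d†Δ_d`, penalty `K = H + (κ/L⁴)A`, `e_S = minEnergyOn H S`, ANY `β, κ > 0`,

  `(κ/L⁴)⟨ψ, A ψ⟩ ≥ -(1/β) log Re tr_S e^{-β(K - e_S)} ≥ (κ/L⁴)⟨A⟩^S_{β,K} - σ/β`,

`σ` = any certified entropy budget: the state count `log Re tr_S e^{-β(H - e_S)}` of the
unpenalised `H`, or the free bound `L² log 4 ≥ log dim S`. LANDED under `Theorems/` (all
`--supports` 2079): Peierls–Jensen (`…SoftminPeierls`, p85438); bookkeeping (p86419, p86460,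
p87760, p89376); frame compression (p90239); R1 transfer `transfer_tower` (p90505); R2 transfer
`transfer_isotropic` (p91004).

PASS-2 RESHAPE (this skeleton): the pass-1 engine stub `stub_penalisedThermalFloor` = (R1 data at
`β = θL²`, `θκx ≥ 4 log 4`) ∨ (R2 data at `β = θL`, state count `≤ C·L/θ`, `4C ≤ θ²κx`) is replaced
by its FREE-SCHEDULE weakening `stub_freePenalisedFloor`: per `(U, L)` the engine picks its own
`β > 0`, `κ > 0` and entropy certificate `σ` subject to ONE budget inequality `4σ ≤ βκx`; only the
floor `x` is uniform. The transfer `stub_transferFree` (= `transfer_free`) is LANDED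
(`Theorems/BalabanIRBirGroundStateAverageLROSoftminTransferFree.lean`, p96119), where
`freeFloor_of_penalisedThermalFloor` shows (pass-1 stub) ⇒ (pass-2 stub): nothing is lost.

OPEN (the only engine content): `stub_freePenalisedFloor` — constructive thermal d-wave pair
order of the κ/L⁴-penalised weakly repulsive Hubbard torus at SOME schedule (crux-sized; the
constructive problem, shared with route cruxes 2R/4R = stmt-14845/14846). WHAT IT IS (landed,
`Theorems/…SoftminPenalisedGroundStates` p97315, `…SoftminThermalFloorOfGroundStates` p98402,
`…SoftminSocketEquiv` p99569): for fixed `δ, U₁, U₂`, `(∃ x > 0, data of this stub) ↔ (∃ y > 0,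
EVERY sector ground state has Re⟨ψ, Δ_d†Δ_d ψ⟩ ≥ yL⁴ for all U in the window, eventually in even L)`
(`exists_freeFloorWindow_iff_exists_everyGroundStateLRO`; constants `x ↦ x/2`, `y ↦ y/8`) — the
socket is every-ground-state d-wave LRO in thermal dress, strictly stronger than the crux's
ground-state AVERAGE. Composition: `BirGroundStateAverageLRO_of`.
-/

noncomputable section

namespace Summit.HubbardSuperconductivity.HubbardSuperconductivity.Theorems.BirGroundStateAverageLRO.Softmin

open Matrix Finset Filter Literature.MathematicalPhysics.QuantumLattice Literature.Probability.LatticeModels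
open Summit.HubbardSuperconductivity.HubbardSuperconductivity.Theses.BalabanIR
open Summit.HubbardSuperconductivity.HubbardSuperconductivity.Theorems
open scoped ComplexOrder

section Hubbard

/-- STUB (THE ENGINE DELIVERABLE, C⁺ of the card in its weakest — free-schedule — form;
crux-sized: the constructive thermal-order problem). For some `δ ∈ (0,1/2)`, window
`0 < U₁ < U₂` and floor `x > 0`: for every `U` in the window, eventually in even `L`, there are an
inverse temperature `β > 0`, a penalty strength `κ > 0` and an entropy budget `σ` with
`4σ ≤ βκx` such that the canonical `(2⌊(1-δ)L²/2⌋, S^z = 0)` Gibbs state at `β` of the penalised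
torus Hamiltonian `K = hubbardTorus 2 L 1 U + (κ/L⁴) Δ_d†Δ_d` has `⟨Δ_d†Δ_d⟩ ≥ x L⁴` (real sector
traces `x L⁴ · Re tr (P_S e^{-βK}) ≤ Re tr (P_S e^{-βK} Δ_d†Δ_d)`), and `σ` is certified either as
the state count of the unpenalised `H` (`log Re tr(P_S e^{-β(H - e_S)}) ≤ σ`, `e_S = minEnergyOn H S`)
or trivially (`L² log 4 ≤ σ`). Instances: R1 (`β = θL²`, `σ = L² log 4`, `θκx ≥ 4 log 4`), R2
(`β = θL`, `σ = C·L/θ`, `4C ≤ θ²κx`). Nothing in the tree proves it at any `U > 0`. -/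
theorem stub_freePenalisedFloor :
    ∃ δ ∈ Set.Ioo (0 : ℝ) (1 / 2), ∃ U₁ U₂ x : ℝ, 0 < U₁ ∧ U₁ < U₂ ∧ 0 < x ∧
      ∀ U ∈ Set.Ioo U₁ U₂, ∃ L₀ : ℕ, ∀ (L : ℕ) [NeZero L], L₀ ≤ L → Even L →
        let N : ℕ := 2 * ⌊(1 - δ) * (L : ℝ) ^ 2 / 2⌋₊
        let H := hubbardTorus 2 L 1 U
        let S := szSector (Λ := FermionTorus 2 L) N 0
        let P := projMatrix (S.map (Fock.toEuclidean (ι := Orb (FermionTorus 2 L)) :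
          Fock (Orb (FermionTorus 2 L)) →ₗ[ℂ] EuclideanSpace ℂ (Finset (Orb (FermionTorus 2 L)))))
        let A := (pairField dWaveFormFactor L)ᴴ * pairField dWaveFormFactor L
        let e : ℝ := H.minEnergyOn S
        ∃ β κ σ : ℝ, 0 < β ∧ 0 < κ ∧ 4 * σ ≤ β * κ * x ∧
          x * (L : ℝ) ^ 4 * (P * gibbsWeight β (H + ((κ / (L : ℝ) ^ 4 : ℝ) : ℂ) • A)).trace.re ≤
            (P * gibbsWeight β (H + ((κ / (L : ℝ) ^ 4 : ℝ) : ℂ) • A) * A).trace.re ∧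
          (Real.log ((P * gibbsWeight β (H - ((e : ℝ) : ℂ) • 1)).trace.re) ≤ σ ∨
            (L : ℝ) ^ 2 * Real.log 4 ≤ σ) := by
  sorry

/-- **Composition of line `Sketch` (pass 2)**: the crux `BirGroundStateAverageLRO` from the engine
stub `stub_freePenalisedFloor` by the free-schedule transfer `stub_transferFree` (landed,
`Theorems/BalabanIRBirGroundStateAverageLROSoftminTransferFree.lean`, p96119). -/
theorem BirGroundStateAverageLRO_of : BirGroundStateAverageLRO := by
  obtain ⟨δ, hδ, U₁, U₂, x, hU₁, hU₁₂, hx, h⟩ := stub_freePenalisedFloor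
  exact stub_transferFree δ U₁ U₂ x hδ hU₁ hU₁₂ hx h

end Hubbard

end Summit.HubbardSuperconductivity.HubbardSuperconductivity.Theorems.BirGroundStateAverageLRO.Softmin
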